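import Literature.Combinatorics.SimpleGraph.HyperellipticInvolution
import HarnessLib

/-!
# The hyperelliptic involution is central and acts as `−1` on the Jacobian (Baker–Norine 2009,
# §5.2 Corollary 57, §5.3 Theorem 58 (1)–(3))

Source (held, read at the page; statements VERBATIM). M. Baker, S. Norine, *Harmonic morphisms
and hyperelliptic graphs*, Int. Math. Res. Not. IMRN 2009, no. 15, 2914–2955 [BakerNorine2009]
(held text `paper:arxiv-0707.1309`, chunks p0019–p0020).
**Corollary 57.** «If `G` is a 2-edge-connected hyperelliptic graph with hyperelliptic involution
`ι`, then `ι` belongs to the center of the group `Aut(G)`.» (proof: «Let `τ ∈ Aut(G)`, and consider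
the automorphism `ι′ := τ⁻¹ιτ`. […] `G/ι′` is a tree. By Corollary 54, we have `ι′ = ι`».)
§5.3, **Theorem 58.** «Let `G` be a 2-edge-connected graph of genus `g ≥ 2`, and let `ι ∈ Aut(G)`.
Then the following are equivalent: (1) `G` is hyperelliptic with hyperelliptic involution `ι`.
(2) `ι_* : Jac(G) → Jac(G)` is multiplication by `−1`. (3) `ι^* : Jac(G) → Jac(G)` is
multiplication by `−1`. (4) `ι_* : ℋ¹(G) → ℋ¹(G)` is multiplication by `−1`. (5) `ι^* : ℋ¹(G) →
ℋ¹(G)` is multiplication by `−1`.» Proof: «Since `ι` is a harmonic morphism of degree `1` from `G`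
to itself, `ι_* ∘ ι^*` is the identity map on both `Jac(G)` and `ℋ¹(G)`. It follows easily that
(2) ⇔ (3) […]. (1) ⇒ (2). If `G` is hyperelliptic with hyperelliptic involution `ι`, then by
Corollary 53, for every `x, y ∈ V(G)`, we have `(x) + (ι(x)) ∼ (y) + (ι(y))`. Thus
`(x) − (y) ∼ (ι(y)) − (ι(x)) = ι_*((y) − (x))`. Since the group `Div⁰(G)` is generated by divisors of
the form `(x) − (y)`, it follows that `ι_* ≡ −1` on `Jac(G)`. (2) ⇒ (1). If `ι_* ≡ −1` on `Jac(G)`,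
then `(x) + (ι(x)) ∼ (y) + (ι(y))` for all `x, y ∈ V(G)`. In particular, for any `x ∈ V(G)`, we
have `r((x) + (ι(x))) = 1`. Thus `G` is hyperelliptic. By Remark 56, `ι` is the hyperelliptic
involution on `G`.»

## What is formalised (simple graphs; `Jac(G) = criticalGroup G`, `ι_* = jacPushforward`,
## `ι^* = jacPullback` of `HarmonicMorphismsPushforward` for the harmonic morphism of an
## automorphism `γ : G ≃g G` (`isHarmonicMorphism_iso`); «hyperelliptic involution» = tree
## involution of `HyperellipticInvolution`: `IsInvolutiveAut ∧ quotientGraph IsTree ∧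
## HasSimpleEdgeOrbits`)

* §1 push-forward along an automorphism: `γ_* D = D ∘ γ⁻¹`, and the pair computation
  `γ_* D + D = Σ_x D(x)·((γ x) + (x))`; pairwise-equivalent pairs give `r((x) + (κ x)) = 1`;
* §2 **Corollary 57** (`tree_involution_comm`: `ι (τ x) = τ (ι x)` for every `τ : G ≃g G`; here
  through Corollary 53 pushed forward along `τ⁻¹` and Remark 56, instead of the quotient
  isomorphism `G/ι′ ≅ G/ι`);
* §3 **Theorem 58 (1) ⇔ (2) ⇔ (3)**: divisor form `γ_* D ∼ −D` on `Div⁰`, and on `Jac(G)`;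
  (2) ⇔ (3) from `γ_* ∘ γ^* = id` (degree `1`, Lemma 24).
Statements (4), (5) concern harmonic `1`-forms (flows) and are not typed here.

Theorems only (no new definitions); no `sorry`; no named facts.
-/

open Finset SimpleGraph Matrix
open Literature.Combinatorics.SimpleGraph.ChipFiring

namespace Literature.Combinatorics.SimpleGraph.BakerNorine

universe u

variable {V : Type u} [Fintype V] [DecidableEq V] {G : SimpleGraph V} [DecidableRel G.Adj]

/-! ### §1 Push-forward along an automorphism; pairs -/

omit [DecidableRel G.Adj] in
omit [Fintype V] [DecidableEq V] in
/-- `γ x = y ↔ x = γ⁻¹ y` for an automorphism. [cite: BakerNorine2009, Example 20] -/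
theorem iso_apply_eq_iff (γ : G ≃g G) {x y : V} : γ x = y ↔ x = γ.symm y := by
  constructor
  · rintro rfl; exact (γ.symm_apply_apply x).symm
  · rintro rfl; exact γ.apply_symm_apply y

omit [DecidableRel G.Adj] in
/-- Push-forward along an automorphism: `γ_* D = D ∘ γ⁻¹`.
[cite: BakerNorine2009, §2.3 (eq. (2.4)) with Example 20] -/
theorem divPushforward_iso_apply (γ : G ≃g G) (D : V → ℤ) (y : V) :
    divPushforward γ D y = D (γ.symm y) := by
  rw [divPushforward_apply]
  have : univ.filter (fun x => γ x = y) = {γ.symm y} := by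
    ext x
    simp only [mem_filter, mem_univ, true_and, mem_singleton, iso_apply_eq_iff]
  rw [this, Finset.sum_singleton]

omit [DecidableRel G.Adj] in
/-- `γ_*((x) + (y)) = (γ x) + (γ y)`. [cite: BakerNorine2009, §2.3 (eq. (2.4))] -/
theorem divPushforward_iso_pair (γ : G ≃g G) (x y : V) :
    divPushforward γ (Pi.single x 1 + Pi.single y 1 : V → ℤ) = Pi.single (γ x) 1 + Pi.single (γ y) 1 := by
  rw [divPushforward_add, divPushforward_single, divPushforward_single]

omit [DecidableRel G.Adj] in
/-- The computation behind (1) ⇒ (2): `γ_* D + D = Σ_x D(x) · ((γ x) + (x))`.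
[cite: BakerNorine2009, Theorem 58 (proof of (1) ⇒ (2): «`Div⁰(G)` is generated by divisors of
the form `(x) − (y)`»)] -/
theorem divPushforward_iso_add_self (γ : G ≃g G) (D : V → ℤ) :
    divPushforward γ D + D = ∑ x, D x • (Pi.single x 1 + Pi.single (γ x) 1 : V → ℤ) := by
  funext z
  rw [Pi.add_apply, divPushforward_iso_apply, Finset.sum_apply]
  simp only [Pi.smul_apply, smul_eq_mul, single_add_single_apply, mul_add, mul_ite, mul_one,
    mul_zero, Finset.sum_add_distrib]
  have h1 : ∑ x, (if z = γ x then D x else 0) = D (γ.symm z) := by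
    have : ∀ x, (z = γ x) ↔ (γ.symm z = x) := fun x => by
      rw [eq_comm, iso_apply_eq_iff, eq_comm]
    simp only [this, Finset.sum_ite_eq, mem_univ, if_true]
  have h2 : ∑ x, (if z = x then D x else 0) = D z := by
    rw [Finset.sum_ite_eq, if_pos (mem_univ z)]
  simp only [h1, h2, add_comm]

/-- Linear equivalence is compatible with integer linear combinations.
[cite: BakerNorine2007, §1.6 («`Prin(G)` is a subgroup»)] -/
theorem linEquiv_sum_smul {α : Type*} (s : Finset α) (c : α → ℤ) {A B : α → V → ℤ}
    (h : ∀ a ∈ s, LinEquiv G (A a) (B a)) :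
    LinEquiv G (∑ a ∈ s, c a • A a) (∑ a ∈ s, c a • B a) := by
  rw [linEquiv_iff, ← Finset.sum_sub_distrib]
  refine AddSubgroup.sum_mem _ fun a ha => ?_
  rw [← smul_sub]
  exact AddSubgroup.zsmul_mem _ ((linEquiv_iff G _ _).1 (h a ha)) _

/-- If the pairs `(x) + (γ x)` of an automorphism `γ` are pairwise linearly equivalent, then
`γ_* D ∼ −D` for every `D ∈ Div⁰(G)` («Thus `(x) − (y) ∼ (ι(y)) − (ι(x)) = ι_*((y) − (x))` […]
it follows that `ι_* ≡ −1`»). [cite: BakerNorine2009, Theorem 58 (proof of (1) ⇒ (2))] -/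
theorem linEquiv_divPushforward_neg_of_pairs (γ : G ≃g G)
    (h : ∀ x y : V, LinEquiv G (Pi.single x 1 + Pi.single (γ x) 1) (Pi.single y 1 + Pi.single (γ y) 1))
    {D : V → ℤ} (hD : ∑ v, D v = 0) : LinEquiv G (divPushforward γ D) (-D) := by
  -- `γ_* D + D = Σ_x D(x)·((γ x) + (x)) ∼ Σ_x D(x)·P₀ = (Σ D)·P₀ = 0`
  rcases isEmpty_or_nonempty V with hV | ⟨⟨v₀⟩⟩
  · have h0 : divPushforward γ D - -D = 0 := funext fun z => (IsEmpty.false z).elim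
    rw [linEquiv_iff, h0]
    exact zero_mem _
  have h1 : LinEquiv G (∑ x, D x • (Pi.single x 1 + Pi.single (γ x) 1 : V → ℤ))
      (∑ x, D x • (Pi.single v₀ 1 + Pi.single (γ v₀) 1 : V → ℤ)) :=
    linEquiv_sum_smul univ D fun x _ => h x v₀
  rw [← Finset.sum_smul, hD, zero_smul, ← divPushforward_iso_add_self] at h1
  have := h1.sub_right D
  rwa [add_sub_cancel_right, zero_sub] at this

/-- Conversely `γ_*((x) − (y)) ∼ (y) − (x)` gives `(x) + (γ x) ∼ (y) + (γ y)` («If `ι_* ≡ −1` on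
`Jac(G)`, then `(x) + (ι(x)) ∼ (y) + (ι(y))` for all `x, y`»).
[cite: BakerNorine2009, Theorem 58 (proof of (2) ⇒ (1))] -/
theorem linEquiv_pairs_of_divPushforward_neg (γ : G ≃g G)
    (h : ∀ D : V → ℤ, ∑ v, D v = 0 → LinEquiv G (divPushforward γ D) (-D)) (x y : V) :
    LinEquiv G (Pi.single x 1 + Pi.single (γ x) 1) (Pi.single y 1 + Pi.single (γ y) 1) := by
  have hF : ∑ v, (Pi.single x 1 - Pi.single y 1 : V → ℤ) v = 0 := by
    simp only [Pi.sub_apply, Finset.sum_sub_distrib, Finset.sum_pi_single', mem_univ, if_true,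
      sub_self]
  have h1 := h _ hF
  rw [divPushforward_sub, divPushforward_single, divPushforward_single, linEquiv_iff] at h1
  rw [linEquiv_iff]
  convert h1 using 1
  abel

/-- Pairwise-equivalent pairs have `r((x) + (κ x)) = 1` (`g ≥ 2`) («In particular, for any
`x ∈ V(G)`, we have `r((x) + (ι(x))) = 1`»). [cite: BakerNorine2009, Theorem 58 (proof of
(2) ⇒ (1)); Corollary 53] -/
theorem rank_pair_eq_one_of_forall_linEquiv (hG : G.Connected) (hg : 2 ≤ genus G) {κ : V → V}
    (h : ∀ x y : V, LinEquiv G (Pi.single x 1 + Pi.single (κ x) 1) (Pi.single y 1 + Pi.single (κ y) 1))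
    (x : V) : rank G (Pi.single x 1 + Pi.single (κ x) 1) = 1 := by
  haveI : Nonempty V := hG.nonempty
  refine (rank_eq_one_iff_of_sum_eq_two hG hg (sum_single_add_single _ _)).2 ?_
  rw [show (1 : ℤ) = ((1 : ℕ) : ℤ) from rfl, le_rank_iff]
  intro E hE hEs
  obtain ⟨z, rfl⟩ := eq_single_of_nonneg_of_sum_eq_one hE (by exact_mod_cast hEs)
  refine ⟨Pi.single (κ z) 1, fun v => ?_, ?_⟩
  · by_cases hv : v = κ z
    · subst hv; simp
    · simp [hv]
  · have := (h x z).sub_right (Pi.single z 1)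
    rwa [add_sub_cancel_left] at this

/-! ### §2 Corollary 57: the hyperelliptic involution is central -/

/-- **Corollary 57**: the hyperelliptic (tree) involution commutes with every automorphism:
`ι (τ x) = τ (ι x)` («`ι` belongs to the center of the group `Aut(G)`»; here: the pairs of
`ι′ = τ⁻¹ιτ` are the push-forwards along `τ⁻¹` of the pairs of `ι` at `τ x`, hence pairwise
equivalent, so `r((x) + (ι′ x)) = 1` and Remark 56 gives `ι′ = ι`).
[cite: BakerNorine2009, Corollary 57] -/
theorem tree_involution_comm (hG : G.Connected) (h2 : G.IsEdgeConnected 2) (hg : 2 ≤ genus G)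
    {ι : V → V} (hι : IsInvolutiveAut G ι) (hT : (quotientGraph G ι).IsTree)
    (hs : HasSimpleEdgeOrbits G ι) (τ : G ≃g G) (x : V) : ι (τ x) = τ (ι x) := by
  have hV := two_lt_card_of_two_le_genus hG hg
  -- the pairs of `ι′ = τ⁻¹ ι τ` are pairwise linearly equivalent
  have hpairs : ∀ a b : V, LinEquiv G (Pi.single a 1 + Pi.single (τ.symm (ι (τ a))) 1)
      (Pi.single b 1 + Pi.single (τ.symm (ι (τ b))) 1) := by
    intro a b
    have h1 := linEquiv_pair_of_isTree_quotientGraph hG h2 hV hι hT hs (τ a) (τ b)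
    have h2' := (isHarmonicMorphism_iso τ.symm).linEquiv_divPushforward h1
    rw [divPushforward_iso_pair, divPushforward_iso_pair, RelIso.symm_apply_apply,
      RelIso.symm_apply_apply] at h2'
    exact h2'
  have hr := rank_pair_eq_one_of_forall_linEquiv hG hg hpairs x
  have heq := eq_apply_of_rank_pair_eq_one hG h2 hV hι hT hs hg hr
  -- `τ⁻¹ (ι (τ x)) = ι x`
  have := congrArg τ heq
  rwa [RelIso.apply_symm_apply] at this

/-! ### §3 Theorem 58 (1) ⇔ (2) ⇔ (3) -/

section Jacobian

variable (hG : G.Connected) (h2 : G.IsEdgeConnected 2) (hg : 2 ≤ genus G) (γ : G ≃g G)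
include hG h2 hg

/-- **Theorem 58 (1) ⇒ (2), divisor form**: for the tree involution, `γ_* D ∼ −D` on `Div⁰(G)`.
[cite: BakerNorine2009, Theorem 58 (proof of (1) ⇒ (2))] -/
theorem linEquiv_divPushforward_neg_of_isTree_quotientGraph (hι : IsInvolutiveAut G γ)
    (hT : (quotientGraph G γ).IsTree) (hs : HasSimpleEdgeOrbits G γ) {D : V → ℤ}
    (hD : ∑ v, D v = 0) : LinEquiv G (divPushforward γ D) (-D) :=
  linEquiv_divPushforward_neg_of_pairs γ
    (linEquiv_pair_of_isTree_quotientGraph hG h2 (two_lt_card_of_two_le_genus hG hg) hι hT hs) hD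

/-- **Theorem 58 (2) ⇒ (1), divisor form**: if `γ_* D ∼ −D` on `Div⁰(G)` then `γ` is the tree
(hyperelliptic) involution («Thus `G` is hyperelliptic. By Remark 56, `ι` is the hyperelliptic
involution on `G`»). [cite: BakerNorine2009, Theorem 58 (proof of (2) ⇒ (1))] -/
theorem isTree_quotientGraph_of_divPushforward_neg
    (h : ∀ D : V → ℤ, ∑ v, D v = 0 → LinEquiv G (divPushforward γ D) (-D)) :
    IsInvolutiveAut G γ ∧ (quotientGraph G γ).IsTree ∧ HasSimpleEdgeOrbits G γ := by
  have hV := two_lt_card_of_two_le_genus hG hg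
  have hpairs := linEquiv_pairs_of_divPushforward_neg γ h
  have hr := rank_pair_eq_one_of_forall_linEquiv hG hg hpairs
  -- `G` is hyperelliptic, so it has a tree involution `ι₀`; by Remark 56, `γ = ι₀`
  obtain ⟨x₀⟩ := hG.nonempty
  have hhyp : IsHyperelliptic G := ⟨_, sum_single_add_single x₀ (γ x₀), hr x₀⟩
  obtain ⟨ι₀, hι₀, hT₀, hs₀⟩ := (isHyperelliptic_iff_hasTreeInvolution hG h2 hg).1 hhyp
  have heq : (⇑γ : V → V) = ι₀ :=
    funext fun x => eq_apply_of_rank_pair_eq_one hG h2 hV hι₀ hT₀ hs₀ hg (hr x)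
  rw [heq]
  exact ⟨hι₀, hT₀, hs₀⟩

/-- **Theorem 58 (1) ⇔ (2), divisor form.** [cite: BakerNorine2009, Theorem 58] -/
theorem isTree_quotientGraph_iff_divPushforward_neg :
    (IsInvolutiveAut G γ ∧ (quotientGraph G γ).IsTree ∧ HasSimpleEdgeOrbits G γ) ↔
      ∀ D : V → ℤ, ∑ v, D v = 0 → LinEquiv G (divPushforward γ D) (-D) :=
  ⟨fun h _ hD => linEquiv_divPushforward_neg_of_isTree_quotientGraph hG h2 hg γ h.1 h.2.1 h.2.2 hD,
    isTree_quotientGraph_of_divPushforward_neg hG h2 hg γ⟩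

/-- **Theorem 58 (1) ⇔ (2)**: `γ` is the hyperelliptic involution iff `γ_* : Jac(G) → Jac(G)` is
multiplication by `−1`. [cite: BakerNorine2009, Theorem 58] -/
theorem isTree_quotientGraph_iff_jacPushforward_eq_neg :
    (IsInvolutiveAut G γ ∧ (quotientGraph G γ).IsTree ∧ HasSimpleEdgeOrbits G γ) ↔
      ∀ c : criticalGroup G, (isHarmonicMorphism_iso γ).jacPushforward c = -c := by
  rw [isTree_quotientGraph_iff_divPushforward_neg hG h2 hg γ]
  constructor
  · intro h c
    obtain ⟨D, rfl⟩ := QuotientAddGroup.mk_surjective c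
    rw [(isHarmonicMorphism_iso γ).jacPushforward_mk, ← QuotientAddGroup.mk_neg,
      mk_eq_mk_iff_linEquiv]
    exact h D ((mem_zeroSumLattice_iff _).1 D.2)
  · intro h D hD
    have := h (QuotientAddGroup.mk ⟨D, (mem_zeroSumLattice_iff _).2 hD⟩)
    rw [(isHarmonicMorphism_iso γ).jacPushforward_mk, ← QuotientAddGroup.mk_neg,
      mk_eq_mk_iff_linEquiv] at this
    exact this

omit h2 hg in
/-- «Since `ι` is a harmonic morphism of degree `1` from `G` to itself, `ι_* ∘ ι^*` is the
identity map» on `Jac(G)`. [cite: BakerNorine2009, Theorem 58 (proof)] -/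
theorem jacPushforward_jacPullback_iso [Nontrivial V] (c : criticalGroup G) :
    (isHarmonicMorphism_iso γ).jacPushforward ((isHarmonicMorphism_iso γ).jacPullback hG c) = c := by
  obtain ⟨x₀⟩ := hG.nonempty
  rw [(isHarmonicMorphism_iso γ).jacPushforward_jacPullback hG (γ x₀),
    harmonicDegree_iso γ (hG.preconnected.degree_pos_of_nontrivial x₀), one_smul]

omit h2 hg in
/-- **Theorem 58 (2) ⇔ (3)**: `γ_* = −1` on `Jac(G)` iff `γ^* = −1` on `Jac(G)` («It follows
easily» from `γ_* ∘ γ^* = id`). [cite: BakerNorine2009, Theorem 58] -/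
theorem jacPushforward_eq_neg_iff_jacPullback_eq_neg [Nontrivial V] :
    (∀ c : criticalGroup G, (isHarmonicMorphism_iso γ).jacPushforward c = -c) ↔
      ∀ c : criticalGroup G, (isHarmonicMorphism_iso γ).jacPullback hG c = -c := by
  constructor
  · intro h c
    have h1 := jacPushforward_jacPullback_iso hG γ c
    rw [h] at h1
    exact neg_eq_iff_eq_neg.1 h1
  · intro h c
    have h1 := jacPushforward_jacPullback_iso hG γ (-c)
    rw [h, neg_neg] at h1
    exact h1

/-- **Theorem 58 (1) ⇔ (3)**: `γ` is the hyperelliptic involution iff `γ^* : Jac(G) → Jac(G)` is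
multiplication by `−1`. [cite: BakerNorine2009, Theorem 58] -/
theorem isTree_quotientGraph_iff_jacPullback_eq_neg :
    (IsInvolutiveAut G γ ∧ (quotientGraph G γ).IsTree ∧ HasSimpleEdgeOrbits G γ) ↔
      ∀ c : criticalGroup G, (isHarmonicMorphism_iso γ).jacPullback hG c = -c := by
  haveI : Nontrivial V := by
    have hV := two_lt_card_of_two_le_genus hG hg
    exact Fintype.one_lt_card_iff_nontrivial.1 (by omega)
  rw [isTree_quotientGraph_iff_jacPushforward_eq_neg hG h2 hg γ,
    jacPushforward_eq_neg_iff_jacPullback_eq_neg hG γ]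

end Jacobian

end Literature.Combinatorics.SimpleGraph.BakerNorine
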